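import Mathlib
import HarnessLib
import Summits.AtomisticToContinuum.FouriersLaw.Theorems.JunctionLocalityDefs
import Summits.AtomisticToContinuum.FouriersLaw.Theorems.JunctionLocalityConductanceLowerBoundStubShortTimeDipoleFloorAux2
import Summits.AtomisticToContinuum.FouriersLaw.Theorems.JunctionLocalityConductanceLowerBoundStubShortTimeDipoleFloorAux4
import Summits.AtomisticToContinuum.FouriersLaw.Theorems.JunctionLocalityNonBallisticLightConeAssemblyPart1

/-!
# Short-time dipole floor, helper 16: from kernel pairings to the annealed coupling (fixed `N` bookkeeping)

Helper (`--supports stmt-AtomisticToContinuum-11749`) for stub `stub_shortTimeDipoleFloor` (S) of line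
`kick-dipole-no-collapse`, crux `JunctionLocality.ConductanceLowerBound`.

The contact power pairing `Φ_N(s) = ∫ a₀ · (κ_s J) dμ_T` (`a₀ = p_0 ∂_{q_0}H`, `J = Σ_k j_k`) is a finite sum of bond terms
`I_k(s) = ∫ a₀ · (κ_s j_k) dμ_T` (`integral_contactPower_mul_evolve_totalCurrent_eq_sum`).  Each bond term is transferred to an
expectation under the stationary coupling `π = μ_T ⊗ W` of the strong solutions (`κ_s g(x) = ∫ g(Φ_s(x, Bω)) dW(ω)`):

* `ofReal_abs_integral_mul_le_lintegral_prod` — the abstract transfer `|∫ a · (∫ h dW) dμ| ≤ ∫⁻ |a| |h| d(μ ⊗ W)`;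
* `abs_integral_contactPower_mul_evolve_sub_le` — the contact bond: `|I_0(s) − I_0(0)|` is bounded by the annealed
  displacement functional of helper 15;
* `integral_contactPower_mul_evolve_eq_half`, `abs_integral_contactPower_mul_evolve_le` — a far bond: `a₀` is odd and `μ_T`
  invariant under the flip of `p_0`, so `I_k(s) = ½ ∫ a₀ (κ_s j_k − κ_s j_k ∘ Θ₀) dμ_T` and `|I_k(s)|` is bounded by half the
  annealed flip functional of helper 13;
* `bondCurrent_evolve_facts` — the `L²(μ_T)` bookkeeping (exponential class) behind all of it; `bondCurrent_last` — the
  phantom bond `k = N − 1` carries no current.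
-/

noncomputable section

open MeasureTheory ProbabilityTheory Filter Topology Set
open scoped NNReal ENNReal BigOperators
open Literature.MathematicalPhysics.KineticTheory.HeatConduction
open Literature.Probability.Process
open Summit.AtomisticToContinuum.FouriersLaw.Theorems.JunctionLocality
open Summit.AtomisticToContinuum.FouriersLaw.Theorems
open Summit.AtomisticToContinuum.FouriersLaw.Theorems.SubdiffusiveBondHeat
open Summit.AtomisticToContinuum.FouriersLaw.Theorems.NonBallistic

namespace Summit.AtomisticToContinuum.FouriersLaw.Cruxes.ConductanceLowerBound.KickDipoleNoCollapse

variable {N : ℕ}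

/-! ### The abstract transfer -/

/-- **Transfer of a pairing to the product space.**  For measurable `a : X → ℝ`, jointly measurable `h : X × Ω → ℝ` and
`g(x) = ∫ h(x, ω) dW(ω)`: `|∫ a g dμ| ≤ ∫⁻ |a(x)| |h(x, ω)| d(μ ⊗ W)` (as an `ℝ≥0∞` inequality; no integrability needed). -/
theorem ofReal_abs_integral_mul_le_lintegral_prod {X Ω' : Type*} [MeasurableSpace X] [MeasurableSpace Ω']
    (μ : Measure X) (W : Measure Ω') [SFinite μ] [SFinite W] {a g : X → ℝ} {h : X → Ω' → ℝ} (ham : Measurable a)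
    (hhm : Measurable (Function.uncurry h)) (hg : ∀ x, g x = ∫ ω, h x ω ∂W) :
    ENNReal.ofReal |∫ x, a x * g x ∂μ| ≤ ∫⁻ q, ENNReal.ofReal (|a q.1| * |h q.1 q.2|) ∂(μ.prod W) := by
  have hm : Measurable fun q : X × Ω' => ENNReal.ofReal (|a q.1| * |h q.1 q.2|) :=
    ((ham.comp measurable_fst).abs.mul hhm.abs).ennreal_ofReal
  calc ENNReal.ofReal |∫ x, a x * g x ∂μ| = ‖∫ x, a x * g x ∂μ‖ₑ := (Real.enorm_eq_ofReal_abs _).symm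
    _ ≤ ∫⁻ x, ‖a x * g x‖ₑ ∂μ := enorm_integral_le_lintegral_enorm _
    _ ≤ ∫⁻ x, ∫⁻ ω, ENNReal.ofReal (|a x| * |h x ω|) ∂W ∂μ := by
        refine lintegral_mono fun x => ?_
        rw [Real.enorm_eq_ofReal_abs, abs_mul, ENNReal.ofReal_mul (abs_nonneg _)]
        have h1 : ENNReal.ofReal |g x| ≤ ∫⁻ ω, ENNReal.ofReal |h x ω| ∂W := by
          rw [hg x, ← Real.enorm_eq_ofReal_abs]
          refine (enorm_integral_le_lintegral_enorm _).trans (le_of_eq ?_)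
          exact lintegral_congr fun ω => Real.enorm_eq_ofReal_abs _
        calc ENNReal.ofReal |a x| * ENNReal.ofReal |g x| ≤ ENNReal.ofReal |a x| * ∫⁻ ω, ENNReal.ofReal |h x ω| ∂W :=
              mul_le_mul' le_rfl h1
          _ = ∫⁻ ω, ENNReal.ofReal |a x| * ENNReal.ofReal |h x ω| ∂W :=
              (lintegral_const_mul' _ _ ENNReal.ofReal_ne_top).symm
          _ = ∫⁻ ω, ENNReal.ofReal (|a x| * |h x ω|) ∂W :=
              lintegral_congr fun ω => (ENNReal.ofReal_mul (abs_nonneg _)).symm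
    _ = ∫⁻ q, ENNReal.ofReal (|a q.1| * |h q.1 q.2|) ∂(μ.prod W) := (lintegral_prod _ hm.aemeasurable).symm

/-! ### Fixed-`N` facts -/

/-- The phantom bond `k = N − 1` carries no current: `P.bondCurrent N k = 0` when `k + 1 = N`. -/
theorem bondCurrent_last (P : OscillatorChain) {k : Fin N} (hk : k.val + 1 = N) (x : PhaseSpace N) :
    P.bondCurrent N k x = 0 := by
  unfold OscillatorChain.bondCurrent
  refine Finset.sum_eq_zero fun j _ => ?_
  rw [if_neg]
  have := j.isLt
  omega

/-- The contact power `a₀ = p_0 ∂_{q_0}H` is odd under the flip of `p_0`. -/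
theorem contactPower_momentumFlip (P : OscillatorChain) (hN : 0 < N) (x : PhaseSpace N) :
    (momentumFlip ⟨0, hN⟩ x).2 ⟨0, hN⟩ * partialQ ⟨0, hN⟩ (P.hamiltonian N) (momentumFlip ⟨0, hN⟩ x) =
      -(x.2 ⟨0, hN⟩ * partialQ ⟨0, hN⟩ (P.hamiltonian N) x) := by
  rw [partialQ_hamiltonian_momentumFlip, momentumFlip_snd_self]
  ring

/-- **Flip symmetrisation.**  For `a` odd under a momentum flip `Θ` (which preserves `μ_T`) and `g` with `a·g`, `a·(g∘Θ)`
integrable: `∫ a g dμ_T = ½ ∫ a (g − g∘Θ) dμ_T`. -/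
theorem integral_oddMul_eq_half (P : OscillatorChain) (N : ℕ) (T : ℝ) (i : Fin N) {a g : PhaseSpace N → ℝ}
    (ha : ∀ x, a (momentumFlip i x) = -a x)
    (h1 : Integrable (fun x => a x * g x) (P.gibbsMeasure N T))
    (h2 : Integrable (fun x => a x * g (momentumFlip i x)) (P.gibbsMeasure N T)) :
    ∫ x, a x * g x ∂(P.gibbsMeasure N T) = 1 / 2 * ∫ x, a x * (g x - g (momentumFlip i x)) ∂(P.gibbsMeasure N T) := by
  have h0 := integral_eq_zero_of_momentumFlip_odd P N T i (F := fun x => a x * (g x + g (momentumFlip i x)))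
    (fun x => by rw [ha, momentumFlip_momentumFlip]; ring)
  have e1 : ∫ x, a x * (g x + g (momentumFlip i x)) ∂(P.gibbsMeasure N T) =
      (∫ x, a x * g x ∂(P.gibbsMeasure N T)) + ∫ x, a x * g (momentumFlip i x) ∂(P.gibbsMeasure N T) := by
    rw [← integral_add h1 h2]
    exact integral_congr_ae (Eventually.of_forall fun x => by ring)
  have e2 : ∫ x, a x * (g x - g (momentumFlip i x)) ∂(P.gibbsMeasure N T) =
      (∫ x, a x * g x ∂(P.gibbsMeasure N T)) - ∫ x, a x * g (momentumFlip i x) ∂(P.gibbsMeasure N T) := by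
    rw [← integral_sub h1 h2]
    exact integral_congr_ae (Eventually.of_forall fun x => by ring)
  rw [e1] at h0
  rw [e2]
  linarith

section Pinned

variable {ω₂ lam β γ : ℝ} (hω : 0 < ω₂) (hl : 0 < lam) (hβ : 0 < β) (hγ : 0 < γ) (hN : 0 < N) {T : ℝ} (hT : 0 < T)
include hω hl hβ hγ hN hT

local notation "𝐏" => pinnedChain ω₂ lam β γ

/-- **`L²(μ_T)` bookkeeping of one bond current** (exponential class): `j_k` is integrable against every kernel `κ_s(z, ·)`;
`j_k², (κ_s j_k)² ∈ L¹(μ_T)`; `κ_s j_k` is strongly measurable; and `a₀ · κ_s j_k`, `a₀ · (κ_s j_k ∘ Θ₀)`, `a₀ · j_k ∈ L¹(μ_T)`. -/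
theorem bondCurrent_evolve_facts (k : Fin N) (s : ℝ) :
    (∀ z, Integrable ((pinnedChain ω₂ lam β γ).bondCurrent N k) ((pinnedChain ω₂ lam β γ).transitionKernel N T T s.toNNReal z)) ∧
    Integrable (fun z => (pinnedChain ω₂ lam β γ).bondCurrent N k z ^ 2) ((pinnedChain ω₂ lam β γ).gibbsMeasure N T) ∧
    Integrable (fun z => (evolve (pinnedChain ω₂ lam β γ) N T ((pinnedChain ω₂ lam β γ).bondCurrent N k) s z) ^ 2)
      ((pinnedChain ω₂ lam β γ).gibbsMeasure N T) ∧
    StronglyMeasurable (evolve (pinnedChain ω₂ lam β γ) N T ((pinnedChain ω₂ lam β γ).bondCurrent N k) s) ∧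
    Integrable (fun z => (z.2 ⟨0, hN⟩ * partialQ ⟨0, hN⟩ ((pinnedChain ω₂ lam β γ).hamiltonian N) z) *
      evolve (pinnedChain ω₂ lam β γ) N T ((pinnedChain ω₂ lam β γ).bondCurrent N k) s z) ((pinnedChain ω₂ lam β γ).gibbsMeasure N T) ∧
    Integrable (fun z => (z.2 ⟨0, hN⟩ * partialQ ⟨0, hN⟩ ((pinnedChain ω₂ lam β γ).hamiltonian N) z) *
      evolve (pinnedChain ω₂ lam β γ) N T ((pinnedChain ω₂ lam β γ).bondCurrent N k) s (momentumFlip ⟨0, hN⟩ z))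
      ((pinnedChain ω₂ lam β γ).gibbsMeasure N T) ∧
    Integrable (fun z => (z.2 ⟨0, hN⟩ * partialQ ⟨0, hN⟩ ((pinnedChain ω₂ lam β γ).hamiltonian N) z) *
      (pinnedChain ω₂ lam β γ).bondCurrent N k z) ((pinnedChain ω₂ lam β γ).gibbsMeasure N T) := by
  obtain ⟨hϑ0, h2ϑ⟩ := LightConeBondHeat.quarter_inv_temp_admissible hT
  have hϑ1 : 1 / (4 * T) < 1 / T := one_div_lt_one_div_of_lt hT (by linarith)
  obtain ⟨Kj, -, hKb⟩ := FiniteResponse.abs_bondCurrent_le_exp hω hl.le hβ hN hϑ0 k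
  have hjc : Continuous ((𝐏).bondCurrent N k) := pinnedChain_continuous_bondCurrent ω₂ lam β γ N k
  have h1 : ∀ z, Integrable ((𝐏).bondCurrent N k) ((𝐏).transitionKernel N T T s.toNNReal z) := fun z =>
    integrable_of_abs_le_exp
      (pinnedChain_integrable_exp_mul_hamiltonian_transitionKernel hω hl.le hT hβ.le hγ.le hN hϑ0 hϑ1 s.toNNReal z) hjc hKb
  obtain ⟨hj2, hPj2, -⟩ := pinnedChain_integral_sq_act_le hω hl.le hβ hγ hN hT hϑ0 h2ϑ hjc hKb s.toNNReal
  have hsm : StronglyMeasurable (evolve 𝐏 N T ((𝐏).bondCurrent N k) s) :=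
    hjc.stronglyMeasurable.integral_kernel (κ := (𝐏).transitionKernel N T T s.toNNReal)
  obtain ⟨C, -, -, -, hac, hab, -, -⟩ := contactObs_facts hω hl hβ hγ hN hT
  obtain ⟨-, ha2, -, -, -⟩ := expClass_facts hω hl hβ hγ hN hT hac hab 0
  have hmp := (𝐏).measurePreserving_momentumFlip_gibbsMeasure N T ⟨0, hN⟩
  have hPj2' : Integrable (fun z => (evolve 𝐏 N T ((𝐏).bondCurrent N k) s (momentumFlip ⟨0, hN⟩ z)) ^ 2) ((𝐏).gibbsMeasure N T) :=
    (hmp.integrable_comp (hsm.measurable.pow_const 2).aestronglyMeasurable).2 hPj2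
  refine ⟨h1, hj2, hPj2, hsm, ?_, ?_, ?_⟩
  · exact integrable_mul_of_sq_aesm hac.aestronglyMeasurable hsm.aestronglyMeasurable ha2 hPj2
  · exact integrable_mul_of_sq_aesm hac.aestronglyMeasurable
      (hsm.measurable.comp (measurable_momentumFlip _)).aestronglyMeasurable ha2 hPj2'
  · exact integrable_mul_of_sq_aesm hac.aestronglyMeasurable hjc.aestronglyMeasurable ha2 hj2

/-- **The contact power pairing is the sum of its bond terms**: `∫ a₀ · κ_s J dμ_T = Σ_k ∫ a₀ · κ_s j_k dμ_T` (every `s`). -/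
theorem integral_contactPower_mul_evolve_totalCurrent_eq_sum (s : ℝ) :
    ∫ z, (z.2 ⟨0, hN⟩ * partialQ ⟨0, hN⟩ ((pinnedChain ω₂ lam β γ).hamiltonian N) z) *
        evolve (pinnedChain ω₂ lam β γ) N T (totalCurrentObs (pinnedChain ω₂ lam β γ) N) s z
        ∂((pinnedChain ω₂ lam β γ).gibbsMeasure N T) =
      ∑ k : Fin N, ∫ z, (z.2 ⟨0, hN⟩ * partialQ ⟨0, hN⟩ ((pinnedChain ω₂ lam β γ).hamiltonian N) z) *
        evolve (pinnedChain ω₂ lam β γ) N T ((pinnedChain ω₂ lam β γ).bondCurrent N k) s z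
        ∂((pinnedChain ω₂ lam β γ).gibbsMeasure N T) := by
  have hk := fun k => bondCurrent_evolve_facts hω hl hβ hγ hN hT k s
  have hpt : ∀ z, evolve 𝐏 N T (totalCurrentObs 𝐏 N) s z = ∑ k : Fin N, evolve 𝐏 N T ((𝐏).bondCurrent N k) s z := by
    intro z
    simp only [evolve_def]
    rw [← integral_finsetSum _ fun k _ => (hk k).1 z]
    rfl
  rw [← integral_finsetSum _ fun k _ => (hk k).2.2.2.2.1]
  refine integral_congr_ae (Eventually.of_forall fun z => ?_)
  dsimp only
  rw [hpt z, Finset.mul_sum]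

/-- **The contact bond, transferred.**  With the annealed displacement bound of helper 15 at `(N, s)` as hypothesis (`s ≥ 0`):
`|∫ a₀ (κ_s j_0 − j_0) dμ_T| ≤ B √s`. -/
theorem abs_integral_contactPower_mul_evolve_sub_le {s B : ℝ} (hs0 : 0 ≤ s) (hB0 : 0 ≤ B * Real.sqrt s)
    (hB : ∫⁻ q, ENNReal.ofReal (|q.1.2 ⟨0, hN⟩ * partialQ ⟨0, hN⟩ ((pinnedChain ω₂ lam β γ).hamiltonian N) q.1| *
        |(pinnedChain ω₂ lam β γ).bondCurrent N ⟨0, hN⟩ ((pinnedChain ω₂ lam β γ).solMap N T T s q.1 (pairPath q.2)) -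
          (pinnedChain ω₂ lam β γ).bondCurrent N ⟨0, hN⟩ q.1|)
        ∂(((pinnedChain ω₂ lam β γ).gibbsMeasure N T).prod wienerPair) ≤ ENNReal.ofReal (B * Real.sqrt s)) :
    |∫ z, (z.2 ⟨0, hN⟩ * partialQ ⟨0, hN⟩ ((pinnedChain ω₂ lam β γ).hamiltonian N) z) *
        (evolve (pinnedChain ω₂ lam β γ) N T ((pinnedChain ω₂ lam β γ).bondCurrent N ⟨0, hN⟩) s z -
          (pinnedChain ω₂ lam β γ).bondCurrent N ⟨0, hN⟩ z) ∂((pinnedChain ω₂ lam β γ).gibbsMeasure N T)| ≤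
      B * Real.sqrt s := by
  set i0 : Fin N := ⟨0, hN⟩ with hi0
  haveI : IsProbabilityMeasure ((𝐏).gibbsMeasure N T) := pinnedChain_isProbabilityMeasure_gibbsMeasure hω hl.le hβ.le γ N hT
  have hjc : Continuous ((𝐏).bondCurrent N i0) := pinnedChain_continuous_bondCurrent ω₂ lam β γ N i0
  have hjm : Measurable ((𝐏).bondCurrent N i0) := hjc.measurable
  have hH1 : ContDiff ℝ 1 ((𝐏).hamiltonian N) := pinnedChain_contDiff_hamiltonian ω₂ lam β γ N
  have ham : Measurable fun x : PhaseSpace N => x.2 i0 * partialQ i0 ((𝐏).hamiltonian N) x :=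
    ((by fun_prop : Continuous fun z : PhaseSpace N => z.2 i0).mul ((𝐏).continuous_partialQ_hamiltonian hH1 _)).measurable
  have hzm : Measurable fun q : PhaseSpace N × WienerPair => (𝐏).solMap N T T s q.1 (pairPath q.2) :=
    pinnedChain_measurable_solMap_pairPath hω hl.le hβ.le hγ.le N T T s
  have hhm : Measurable (Function.uncurry fun (x : PhaseSpace N) (ω : WienerPair) =>
      (𝐏).bondCurrent N i0 ((𝐏).solMap N T T s x (pairPath ω)) - (𝐏).bondCurrent N i0 x) :=
    (hjm.comp hzm).sub (hjm.comp measurable_fst)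
  have hg : ∀ x, evolve 𝐏 N T ((𝐏).bondCurrent N i0) s x - (𝐏).bondCurrent N i0 x =
      ∫ ω, ((𝐏).bondCurrent N i0 ((𝐏).solMap N T T s x (pairPath ω)) - (𝐏).bondCurrent N i0 x) ∂wienerPair := by
    intro x
    have hint : Integrable (fun ω => (𝐏).bondCurrent N i0 ((𝐏).solMap N T T s x (pairPath ω))) wienerPair := by
      simpa only [Real.coe_toNNReal _ hs0] using
        (FSAssembly.integrable_bondCurrent_solMap hω hl.le hβ hγ hN hT i0 s.toNNReal x).1
    have e1 : evolve 𝐏 N T ((𝐏).bondCurrent N i0) s x = ∫ ω, (𝐏).bondCurrent N i0 ((𝐏).solMap N T T s x (pairPath ω)) ∂wienerPair := by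
      rw [evolve_def, pinnedChain_integral_transitionKernel hω hl.le hβ.le hγ.le N T T _ x hjc.aestronglyMeasurable]
      simp only [Real.coe_toNNReal _ hs0]
    rw [e1, integral_sub hint (integrable_const _), integral_const, smul_eq_mul, probReal_univ, one_mul]
  have key := ofReal_abs_integral_mul_le_lintegral_prod ((𝐏).gibbsMeasure N T) wienerPair ham hhm hg
  exact (ENNReal.ofReal_le_ofReal_iff hB0).1 (key.trans hB)

/-- **A far bond, symmetrised**: `∫ a₀ · κ_s j_k dμ_T = ½ ∫ a₀ (κ_s j_k − κ_s j_k ∘ Θ₀) dμ_T` (`a₀` odd, `μ_T` flip invariant). -/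
theorem integral_contactPower_mul_evolve_eq_half (k : Fin N) (s : ℝ) :
    ∫ z, (z.2 ⟨0, hN⟩ * partialQ ⟨0, hN⟩ ((pinnedChain ω₂ lam β γ).hamiltonian N) z) *
        evolve (pinnedChain ω₂ lam β γ) N T ((pinnedChain ω₂ lam β γ).bondCurrent N k) s z
        ∂((pinnedChain ω₂ lam β γ).gibbsMeasure N T) =
      1 / 2 * ∫ z, (z.2 ⟨0, hN⟩ * partialQ ⟨0, hN⟩ ((pinnedChain ω₂ lam β γ).hamiltonian N) z) *
        (evolve (pinnedChain ω₂ lam β γ) N T ((pinnedChain ω₂ lam β γ).bondCurrent N k) s z -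
          evolve (pinnedChain ω₂ lam β γ) N T ((pinnedChain ω₂ lam β γ).bondCurrent N k) s (momentumFlip ⟨0, hN⟩ z))
        ∂((pinnedChain ω₂ lam β γ).gibbsMeasure N T) := by
  obtain ⟨-, -, -, -, h1, h2, -⟩ := bondCurrent_evolve_facts hω hl hβ hγ hN hT k s
  exact integral_oddMul_eq_half 𝐏 N T ⟨0, hN⟩
    (fun x => contactPower_momentumFlip 𝐏 hN x) h1 h2

/-- **A far bond, transferred.**  With the annealed flip bound of helper 13 at `(N, k, s)` as hypothesis (`s ≥ 0`):
`|∫ a₀ · κ_s j_k dμ_T| ≤ D/2`. -/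
theorem abs_integral_contactPower_mul_evolve_le (k : Fin N) {s D : ℝ} (hs0 : 0 ≤ s) (hD0 : 0 ≤ D)
    (hD : ∫⁻ q, ENNReal.ofReal (|q.1.2 ⟨0, hN⟩ * partialQ ⟨0, hN⟩ ((pinnedChain ω₂ lam β γ).hamiltonian N) q.1| *
        |(pinnedChain ω₂ lam β γ).bondCurrent N k
            ((pinnedChain ω₂ lam β γ).solMap N T T s (momentumFlip ⟨0, hN⟩ q.1) (pairPath q.2)) -
          (pinnedChain ω₂ lam β γ).bondCurrent N k ((pinnedChain ω₂ lam β γ).solMap N T T s q.1 (pairPath q.2))|)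
        ∂(((pinnedChain ω₂ lam β γ).gibbsMeasure N T).prod wienerPair) ≤ ENNReal.ofReal D) :
    |∫ z, (z.2 ⟨0, hN⟩ * partialQ ⟨0, hN⟩ ((pinnedChain ω₂ lam β γ).hamiltonian N) z) *
        evolve (pinnedChain ω₂ lam β γ) N T ((pinnedChain ω₂ lam β γ).bondCurrent N k) s z
        ∂((pinnedChain ω₂ lam β γ).gibbsMeasure N T)| ≤ D / 2 := by
  set i0 : Fin N := ⟨0, hN⟩ with hi0
  haveI : IsProbabilityMeasure ((𝐏).gibbsMeasure N T) := pinnedChain_isProbabilityMeasure_gibbsMeasure hω hl.le hβ.le γ N hT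
  have hjc : Continuous ((𝐏).bondCurrent N k) := pinnedChain_continuous_bondCurrent ω₂ lam β γ N k
  have hjm : Measurable ((𝐏).bondCurrent N k) := hjc.measurable
  have hH1 : ContDiff ℝ 1 ((𝐏).hamiltonian N) := pinnedChain_contDiff_hamiltonian ω₂ lam β γ N
  have ham : Measurable fun x : PhaseSpace N => x.2 i0 * partialQ i0 ((𝐏).hamiltonian N) x :=
    ((by fun_prop : Continuous fun z : PhaseSpace N => z.2 i0).mul ((𝐏).continuous_partialQ_hamiltonian hH1 _)).measurable
  have hzm : Measurable fun q : PhaseSpace N × WienerPair => (𝐏).solMap N T T s q.1 (pairPath q.2) :=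
    pinnedChain_measurable_solMap_pairPath hω hl.le hβ.le hγ.le N T T s
  have hΘm : Measurable fun q : PhaseSpace N × WienerPair => (momentumFlip i0 q.1, q.2) :=
    ((measurable_momentumFlip i0).comp measurable_fst).prodMk measurable_snd
  have hz'm : Measurable fun q : PhaseSpace N × WienerPair => (𝐏).solMap N T T s (momentumFlip i0 q.1) (pairPath q.2) := by
    have h := hzm.comp hΘm
    exact h
  have hhm : Measurable (Function.uncurry fun (x : PhaseSpace N) (ω : WienerPair) =>
      (𝐏).bondCurrent N k ((𝐏).solMap N T T s x (pairPath ω)) - (𝐏).bondCurrent N k ((𝐏).solMap N T T s (momentumFlip i0 x) (pairPath ω))) :=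
    (hjm.comp hzm).sub (hjm.comp hz'm)
  have hev : ∀ x, evolve 𝐏 N T ((𝐏).bondCurrent N k) s x = ∫ ω, (𝐏).bondCurrent N k ((𝐏).solMap N T T s x (pairPath ω)) ∂wienerPair := by
    intro x
    rw [evolve_def, pinnedChain_integral_transitionKernel hω hl.le hβ.le hγ.le N T T _ x hjc.aestronglyMeasurable]
    simp only [Real.coe_toNNReal _ hs0]
  have hint : ∀ x, Integrable (fun ω => (𝐏).bondCurrent N k ((𝐏).solMap N T T s x (pairPath ω))) wienerPair := by
    intro x
    simpa only [Real.coe_toNNReal _ hs0] using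
      (FSAssembly.integrable_bondCurrent_solMap hω hl.le hβ hγ hN hT k s.toNNReal x).1
  have hg : ∀ x, evolve 𝐏 N T ((𝐏).bondCurrent N k) s x - evolve 𝐏 N T ((𝐏).bondCurrent N k) s (momentumFlip i0 x) =
      ∫ ω, ((𝐏).bondCurrent N k ((𝐏).solMap N T T s x (pairPath ω)) -
        (𝐏).bondCurrent N k ((𝐏).solMap N T T s (momentumFlip i0 x) (pairPath ω))) ∂wienerPair := by
    intro x
    rw [hev x, hev (momentumFlip i0 x), ← integral_sub (hint x) (hint _)]
  have key := ofReal_abs_integral_mul_le_lintegral_prod ((𝐏).gibbsMeasure N T) wienerPair ham hhm hg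
  have hD' : ∫⁻ q, ENNReal.ofReal (|q.1.2 i0 * partialQ i0 ((𝐏).hamiltonian N) q.1| *
      |(𝐏).bondCurrent N k ((𝐏).solMap N T T s q.1 (pairPath q.2)) -
        (𝐏).bondCurrent N k ((𝐏).solMap N T T s (momentumFlip i0 q.1) (pairPath q.2))|) ∂(((𝐏).gibbsMeasure N T).prod wienerPair) ≤
      ENNReal.ofReal D := by
    refine le_trans (le_of_eq (lintegral_congr fun q => ?_)) hD
    rw [abs_sub_comm]
  have habs := (ENNReal.ofReal_le_ofReal_iff hD0).1 (key.trans hD')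
  rw [integral_contactPower_mul_evolve_eq_half hω hl hβ hγ hN hT k s, abs_mul, abs_of_pos (by norm_num : (0:ℝ) < 1 / 2)]
  linarith

/-- **The contact-bond term at time `0` carries the whole static pairing**: `∫ a₀ j_0 dμ_T = ∫ a₀ J dμ_T ≥ T²/2` (`N ≥ 2`). -/
theorem integral_contactPower_mul_bondCurrent_zero_ge (hN2 : 2 ≤ N) :
    T ^ 2 / 2 ≤ ∫ z, (z.2 ⟨0, hN⟩ * partialQ ⟨0, hN⟩ ((pinnedChain ω₂ lam β γ).hamiltonian N) z) *
        (pinnedChain ω₂ lam β γ).bondCurrent N ⟨0, hN⟩ z ∂((pinnedChain ω₂ lam β γ).gibbsMeasure N T) := by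
  obtain ⟨-, hstat⟩ := helper_kdContactPowerStatics ω₂ lam β γ hω hl hβ hγ T hT N hN2
  have hsum : ∫ z, (z.2 ⟨0, hN⟩ * partialQ ⟨0, hN⟩ ((𝐏).hamiltonian N) z) * totalCurrentObs 𝐏 N z ∂((𝐏).gibbsMeasure N T) =
      ∑ k : Fin N, ∫ z, (z.2 ⟨0, hN⟩ * partialQ ⟨0, hN⟩ ((𝐏).hamiltonian N) z) * (𝐏).bondCurrent N k z ∂((𝐏).gibbsMeasure N T) := by
    rw [← integral_finsetSum _ fun k _ => (bondCurrent_evolve_facts hω hl hβ hγ hN hT k 0).2.2.2.2.2.2]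
    refine integral_congr_ae (Eventually.of_forall fun z => ?_)
    simp only [totalCurrentObs_def, Finset.mul_sum]
  have hval : ∑ k : Fin N, ∫ z, (z.2 ⟨0, hN⟩ * partialQ ⟨0, hN⟩ ((𝐏).hamiltonian N) z) * (𝐏).bondCurrent N k z ∂((𝐏).gibbsMeasure N T) =
      ∫ z, (z.2 ⟨0, hN⟩ * partialQ ⟨0, hN⟩ ((𝐏).hamiltonian N) z) * (𝐏).bondCurrent N ⟨0, hN⟩ z ∂((𝐏).gibbsMeasure N T) := by
    rw [Finset.sum_eq_single ⟨0, hN⟩]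
    · intro k _ hk
      exact integral_contactPower_mul_bondCurrent_of_ne hN (fun h => hk (Fin.ext h))
    · intro h; exact absurd (Finset.mem_univ _) h
  have h := hstat
  rw [hsum, hval] at h
  exact h

end Pinned

/-- **Registered helper `helper_kdPairingTransfer` (stub S, line `kick-dipole-no-collapse`): THE CONTACT POWER PAIRING AS A SUM OF
TRANSFERRED BOND TERMS.**  For the pinned anharmonic chain (all parameters `> 0`), `T > 0`, `N ≥ 1` and every real `s`:
`∫ a₀ · κ_s J dμ_T = Σ_k ∫ a₀ · κ_s j_k dμ_T` (closed form of `integral_contactPower_mul_evolve_totalCurrent_eq_sum`). -/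
theorem helper_kdPairingTransfer : ∀ ω₂ lam β γ : ℝ, 0 < ω₂ → 0 < lam → 0 < β → 0 < γ → ∀ T : ℝ, 0 < T → ∀ (N : ℕ) (hN : 0 < N) (s : ℝ), ∫ z, (z.2 ⟨0, hN⟩ * partialQ ⟨0, hN⟩ ((pinnedChain ω₂ lam β γ).hamiltonian N) z) * evolve (pinnedChain ω₂ lam β γ) N T (totalCurrentObs (pinnedChain ω₂ lam β γ) N) s z ∂((pinnedChain ω₂ lam β γ).gibbsMeasure N T) = ∑ k : Fin N, ∫ z, (z.2 ⟨0, hN⟩ * partialQ ⟨0, hN⟩ ((pinnedChain ω₂ lam β γ).hamiltonian N) z) * evolve (pinnedChain ω₂ lam β γ) N T ((pinnedChain ω₂ lam β γ).bondCurrent N k) s z ∂((pinnedChain ω₂ lam β γ).gibbsMeasure N T) := by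
  intro ω₂ lam β γ hω hl hβ hγ T hT N hN s
  exact integral_contactPower_mul_evolve_totalCurrent_eq_sum hω hl hβ hγ hN hT s

end Summit.AtomisticToContinuum.FouriersLaw.Cruxes.ConductanceLowerBound.KickDipoleNoCollapse

end
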